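import Summits.HodgeConjecture.HodgeConjecture.Theorems.HodgeLocusCensusCubicTypes
import Summits.HodgeConjecture.HodgeConjecture.Theorems.HodgeLocusCensusSecondComponents
import HarnessLib

/-!
# HodgeLocusCensusCubicRank6 — a valid cubic core certificate decides the rank of Movasati's matrix of a signed plane sum on the Fermat CUBIC SIXFOLD (cell pub-hlocus, LEAD gen 5, (T39))
HONEST FRAMING: certified instances and evidence bearing on the general Hodge conjecture; no claim.

MAIN THEOREM `ivhsRankEq3_of_cert6`: for a class L of coordinate planes of X³_6 twisted on the last three pairs, a certificate Ψ with
`Ψ.valid L = true` and a mode enumeration (modeK, off) over the 4 d = 3 types of `HodgeLocusCensusCubicTypes` with the structure facts H1–H3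
give `IvhsRankEq 6 3 r (cplaneList6 L)`, r = Σ_types r_{shape} — the d = 3 transcription of `HodgeLocusCensusPlaneSumRank6.ivhsRankEq_of_cert6`
(pair sums 1 instead of 2, ζ a primitive sixth root with ζ² = ζ − 1 from `primRoot6_facts`, tails on the FIRST 1 pair(s): factors ζ^{Σ i_tail},
ζ^{Σ (j_tail + 1)}). UPPER bound M = U·V through K^r; LOWER bound: the minor on the pivot rows (0, σ_tails ; h, σ_heads − h) and pivot columns
(0, 1 − σ_tails ; g, 1 − σ_heads − g) is (lower triangular, positive-integer diagonal)·(upper triangular, nonzero diagonal) in mode order.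
-/

namespace Summit.HodgeConjecture.HodgeConjecture.HodgeLocus.Census.CubicSum

open TwistCells GrSection

section cert

variable {K : Type*} [Field K] (ζ : K) (L : List (ℤ × ℕ × ℕ × ℕ)) (Ψ : CubicCert) {r : ℕ} (modeK : Fin r → Fin 4) (off : Fin 4 → ℕ)

/-- rows of I_{N} have total degree N = k − 2 = 1. -/
theorem crow_sum6 (i : Fin 8 → ℕ) (hi : i ∈ indexSet 6 3 (6 / 2 * 3 - 6 - 2)) : i 0 + i 1 + i 2 + i 3 + i 4 + i 5 + i 6 + i 7 = 1 := by
  have h := (Finset.mem_filter.mp hi).2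
  rw [Finset.sum_fin_eq_sum_range] at h
  simp [Finset.sum_range_succ] at h
  omega

/-- left factor: U[i, m] = [type(i) = type(m)] · ζ^{Σ i_tails} · A_{shape}[head(i), ℓ(m)](ζ). -/
noncomputable def CU6 : Matrix (indexSet 6 3 (6 / 2 * 3 - 6 - 2)) (Fin r) K := fun i m =>
  if i.1 0 + i.1 1 = csig6_0 (modeK m) ∧ i.1 2 + i.1 3 = csig6_1 (modeK m) ∧ i.1 4 + i.1 5 = csig6_2 (modeK m) ∧ i.1 6 + i.1 7 = csig6_3 (modeK m) then
    ζ ^ (i.1 0) * Z6.eval ζ (Ψ.A (csig6_1 (modeK m)) (csig6_2 (modeK m)) (csig6_3 (modeK m)) (i.1 2) (i.1 4) (i.1 6) (m.1 - off (modeK m))) else 0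

/-- right factor: V[m, j] = [type(j) complementary to type(m)] · ζ^{Σ (j_tail + 1)} · B_{shape}[ℓ(m), head(j)](ζ). -/
noncomputable def CV6 : Matrix (Fin r) (indexSet 6 3 3) K := fun m j =>
  if csig6_0 (modeK m) + (j.1 0 + j.1 1) = 1 ∧ csig6_1 (modeK m) + (j.1 2 + j.1 3) = 1 ∧ csig6_2 (modeK m) + (j.1 4 + j.1 5) = 1 ∧ csig6_3 (modeK m) + (j.1 6 + j.1 7) = 1 then
    ζ ^ (j.1 0 + 1) * Z6.eval ζ (Ψ.B (csig6_1 (modeK m)) (csig6_2 (modeK m)) (csig6_3 (modeK m)) (m.1 - off (modeK m)) (j.1 2) (j.1 4) (j.1 6)) else 0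

/-- ENTRY FORMULA of M_δ for δ = cplaneList6 L on the cubic. -/
theorem ivhsMatrix_cplaneList6_apply (h2 : ζ ^ 2 = ζ - 1) (i : indexSet 6 3 (6 / 2 * 3 - 6 - 2)) (j : indexSet 6 3 3) :
    ivhsMatrix 6 3 ζ (cplaneList6 L) i j =
      if i.1 0 + j.1 0 + (i.1 1 + j.1 1) = 1 ∧ i.1 2 + j.1 2 + (i.1 3 + j.1 3) = 1 ∧ i.1 4 + j.1 4 + (i.1 5 + j.1 5) = 1 ∧ i.1 6 + j.1 6 + (i.1 7 + j.1 7) = 1 then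
        ζ ^ (i.1 0 + j.1 0 + 1) * Z6.eval ζ (core3 L (i.1 2 + j.1 2) (i.1 4 + j.1 4) (i.1 6 + j.1 6)) else 0 := by
  unfold ivhsMatrix
  rw [periodComb_cplaneList6 ζ h2]

/-- STRUCTURE THEOREM: M_δ = U · V through K^r. -/
theorem ivhsMatrix_cplaneList6_eq_mul (h2 : ζ ^ 2 = ζ - 1) (hV : Ψ.valid L = true)
    (H1 : ∀ m : Fin r, off (modeK m) ≤ m.1 ∧ m.1 < off (modeK m) + crs6 Ψ (modeK m)) (H2 : ∀ k : Fin 4, off k + crs6 Ψ k ≤ r)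
    (H3 : ∀ m : Fin r, ∀ k : Fin 4, off k ≤ m.1 → m.1 < off k + crs6 Ψ k → modeK m = k) :
    ivhsMatrix 6 3 ζ (cplaneList6 L) = CU6 ζ Ψ modeK off * CV6 ζ Ψ modeK off := by
  ext i j
  rw [Matrix.mul_apply, ivhsMatrix_cplaneList6_apply ζ L h2]
  by_cases hex : ∃ k : Fin 4, i.1 0 + i.1 1 = csig6_0 k ∧ i.1 2 + i.1 3 = csig6_1 k ∧ i.1 4 + i.1 5 = csig6_2 k ∧ i.1 6 + i.1 7 = csig6_3 k
  · obtain ⟨k₀, q0, q1, q2, q3⟩ := hex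
    obtain ⟨l0, l1, l2, l3⟩ := csig_le6 k₀
    have hU : ∀ m : Fin r, modeK m ≠ k₀ → CU6 ζ Ψ modeK off i m = 0 := by
      intro m hm
      unfold CU6
      rw [if_neg]
      intro h
      exact hm (csig_inj6 _ _ (h.1.symm.trans q0) (h.2.1.symm.trans q1) (h.2.2.1.symm.trans q2) (h.2.2.2.symm.trans q3))
    by_cases hc : csig6_0 k₀ + (j.1 0 + j.1 1) = 1 ∧ csig6_1 k₀ + (j.1 2 + j.1 3) = 1 ∧ csig6_2 k₀ + (j.1 4 + j.1 5) = 1 ∧ csig6_3 k₀ + (j.1 6 + j.1 7) = 1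
    · rw [if_pos ⟨by omega, by omega, by omega, by omega⟩]
      set g : ℕ → K := fun ℓ => ζ ^ (i.1 0) * Z6.eval ζ (Ψ.A (csig6_1 k₀) (csig6_2 k₀) (csig6_3 k₀) (i.1 2) (i.1 4) (i.1 6) ℓ) *
        (ζ ^ (j.1 0 + 1) * Z6.eval ζ (Ψ.B (csig6_1 k₀) (csig6_2 k₀) (csig6_3 k₀) ℓ (j.1 2) (j.1 4) (j.1 6))) with hg
      have hterm : ∀ m : Fin r, CU6 ζ Ψ modeK off i m * CV6 ζ Ψ modeK off m j = if modeK m = k₀ then g (m.1 - off k₀) else 0 := by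
        intro m
        by_cases hm : modeK m = k₀
        · rw [if_pos hm, hg]
          unfold CU6 CV6
          rw [hm, if_pos ⟨q0, q1, q2, q3⟩, if_pos hc]
        · rw [if_neg hm, hU m hm, zero_mul]
      rw [Finset.sum_congr rfl fun m _ => hterm m, PlaneSum.sum_modes modeK off (crs6 Ψ) H1 H2 H3 k₀ g,
        ← CubicCert.factor_eq hV (s0 := csig6_1 k₀) (s1 := csig6_2 k₀) (s2 := csig6_3 k₀) (a := i.1 2) (b := i.1 4) (e := i.1 6)
          (a' := j.1 2) (b' := j.1 4) (e' := j.1 6) (by omega) (by omega) (by omega) (by omega) (by omega) (by omega) (by omega) (by omega) (by omega), Z6.eval_rsum, Finset.mul_sum]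
      exact Finset.sum_congr rfl fun ℓ _ => by
        rw [hg, Z6.eval_mul ζ h2]
        ring
    · rw [if_neg fun h => hc ⟨by omega, by omega, by omega, by omega⟩]
      symm
      refine Finset.sum_eq_zero fun m _ => ?_
      by_cases hm : modeK m = k₀
      · unfold CV6
        rw [hm, if_neg hc, mul_zero]
      · rw [hU m hm, zero_mul]
  · -- a row with some pair sum > 1 (no type): both sides vanish
    have hsum := crow_sum6 i.1 i.2
    have hU : ∀ m : Fin r, CU6 ζ Ψ modeK off i m = 0 := fun m => by
      unfold CU6
      exact if_neg fun h => hex ⟨modeK m, h⟩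
    rw [Finset.sum_eq_zero fun m _ => by rw [hU m, zero_mul], if_neg]
    intro hc
    obtain ⟨c0, c1, c2, c3⟩ := hc
    exact hex (csig_cover6' (i.1 0 + i.1 1) (i.1 2 + i.1 3) (i.1 4 + i.1 5) (i.1 6 + i.1 7) (by omega) (by omega) (by omega) (by omega)
      (by omega))

/-- UPPER BOUND: rank M_δ ≤ r. -/
theorem crank_le_of_cert6 (h2 : ζ ^ 2 = ζ - 1) (hV : Ψ.valid L = true)
    (H1 : ∀ m : Fin r, off (modeK m) ≤ m.1 ∧ m.1 < off (modeK m) + crs6 Ψ (modeK m)) (H2 : ∀ k : Fin 4, off k + crs6 Ψ k ≤ r)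
    (H3 : ∀ m : Fin r, ∀ k : Fin 4, off k ≤ m.1 → m.1 < off k + crs6 Ψ k → modeK m = k) :
    (ivhsMatrix 6 3 ζ (cplaneList6 L)).rank ≤ r := by
  rw [ivhsMatrix_cplaneList6_eq_mul ζ L Ψ modeK off h2 hV H1 H2 H3]
  exact (Matrix.rank_mul_le_left _ _).trans (by simpa using Matrix.rank_le_card_width (CU6 ζ Ψ modeK off))

/-! ### the witness minor -/

/-- the row (0, σ_tails ; h, σ_heads − h) of type k with head h … -/
def cRow6 (k : Fin 4) (h : ℕ × ℕ × ℕ) : Fin 8 → ℕ :=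
  ![0, csig6_0 k, h.1, csig6_1 k - h.1, h.2.1, csig6_2 k - h.2.1, h.2.2, csig6_3 k - h.2.2]
/-- … and the column (0, 1 − σ_tails ; g, 1 − σ_heads − g) of the complementary type with head g. -/
def cCol6 (k : Fin 4) (g : ℕ × ℕ × ℕ) : Fin 8 → ℕ :=
  ![0, 1 - csig6_0 k, g.1, 1 - csig6_1 k - g.1, g.2.1, 1 - csig6_2 k - g.2.1, g.2.2, 1 - csig6_3 k - g.2.2]

/-- the pivot rows lie in I_{k−2} … -/
theorem cRow6_mem (k : Fin 4) (h : ℕ × ℕ × ℕ) (hb : h.1 ≤ csig6_1 k ∧ h.2.1 ≤ csig6_2 k ∧ h.2.2 ≤ csig6_3 k) :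
    cRow6 k h ∈ indexSet 6 3 (6 / 2 * 3 - 6 - 2) := by
  obtain ⟨l0, l1, l2, l3⟩ := csig_le6 k
  have hs := csig_sum6 k
  unfold indexSet
  simp only [Finset.mem_filter, Fintype.mem_piFinset, Finset.mem_range, Fin.forall_fin_succ, Fin.sum_univ_succ]
  simp [cRow6]
  omega

/-- … and the pivot columns in I_3. -/
theorem cCol6_mem (k : Fin 4) (g : ℕ × ℕ × ℕ) (hb : g.1 ≤ 1 - csig6_1 k ∧ g.2.1 ≤ 1 - csig6_2 k ∧ g.2.2 ≤ 1 - csig6_3 k) :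
    cCol6 k g ∈ indexSet 6 3 3 := by
  obtain ⟨l0, l1, l2, l3⟩ := csig_le6 k
  have hs := csig_sum6 k
  unfold indexSet
  simp only [Finset.mem_filter, Fintype.mem_piFinset, Finset.mem_range, Fin.forall_fin_succ, Fin.sum_univ_succ]
  simp [cCol6]
  omega

/-- heads, tails and pair sums of a pivot row … -/
theorem cRow6_val (k : Fin 4) (h : ℕ × ℕ × ℕ) (hb : h.1 ≤ csig6_1 k ∧ h.2.1 ≤ csig6_2 k ∧ h.2.2 ≤ csig6_3 k) :
    cRow6 k h 2 = h.1 ∧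
    cRow6 k h 4 = h.2.1 ∧
    cRow6 k h 6 = h.2.2 ∧
    cRow6 k h 0 = 0 ∧
    cRow6 k h 0 + cRow6 k h 1 = csig6_0 k ∧
    cRow6 k h 2 + cRow6 k h 3 = csig6_1 k ∧
    cRow6 k h 4 + cRow6 k h 5 = csig6_2 k ∧
    cRow6 k h 6 + cRow6 k h 7 = csig6_3 k := by
  simp [cRow6]
  omega

/-- … and of a pivot column. -/
theorem cCol6_val (k : Fin 4) (g : ℕ × ℕ × ℕ) (hb : g.1 ≤ 1 - csig6_1 k ∧ g.2.1 ≤ 1 - csig6_2 k ∧ g.2.2 ≤ 1 - csig6_3 k) :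
    cCol6 k g 2 = g.1 ∧
    cCol6 k g 4 = g.2.1 ∧
    cCol6 k g 6 = g.2.2 ∧
    cCol6 k g 0 = 0 ∧
    csig6_0 k + (cCol6 k g 0 + cCol6 k g 1) = 1 ∧
    csig6_1 k + (cCol6 k g 2 + cCol6 k g 3) = 1 ∧
    csig6_2 k + (cCol6 k g 4 + cCol6 k g 5) = 1 ∧
    csig6_3 k + (cCol6 k g 6 + cCol6 k g 7) = 1 := by
  obtain ⟨l0, l1, l2, l3⟩ := csig_le6 k
  simp [cCol6]
  omega

variable {L Ψ modeK off}

/-- ℓ(m) < r_{shape(m)}. -/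
theorem cmodeL_lt6 (H1 : ∀ m : Fin r, off (modeK m) ≤ m.1 ∧ m.1 < off (modeK m) + crs6 Ψ (modeK m)) (m : Fin r) :
    m.1 - off (modeK m) < crs6 Ψ (modeK m) := by
  have := H1 m
  omega

/-- the box facts of the pivots of mode m. -/
theorem cpivot_box6 (hV : Ψ.valid L = true) (H1 : ∀ m : Fin r, off (modeK m) ≤ m.1 ∧ m.1 < off (modeK m) + crs6 Ψ (modeK m)) (m : Fin r) :
    ((Ψ.rowP (csig6_1 (modeK m)) (csig6_2 (modeK m)) (csig6_3 (modeK m)) (m.1 - off (modeK m))).1 ≤ csig6_1 (modeK m) ∧ (Ψ.rowP (csig6_1 (modeK m)) (csig6_2 (modeK m)) (csig6_3 (modeK m)) (m.1 - off (modeK m))).2.1 ≤ csig6_2 (modeK m) ∧ (Ψ.rowP (csig6_1 (modeK m)) (csig6_2 (modeK m)) (csig6_3 (modeK m)) (m.1 - off (modeK m))).2.2 ≤ csig6_3 (modeK m)) ∧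
    ((Ψ.colP (csig6_1 (modeK m)) (csig6_2 (modeK m)) (csig6_3 (modeK m)) (m.1 - off (modeK m))).1 ≤ 1 - csig6_1 (modeK m) ∧ (Ψ.colP (csig6_1 (modeK m)) (csig6_2 (modeK m)) (csig6_3 (modeK m)) (m.1 - off (modeK m))).2.1 ≤ 1 - csig6_2 (modeK m) ∧ (Ψ.colP (csig6_1 (modeK m)) (csig6_2 (modeK m)) (csig6_3 (modeK m)) (m.1 - off (modeK m))).2.2 ≤ 1 - csig6_3 (modeK m)) := by
  obtain ⟨l0, l1, l2, l3⟩ := csig_le6 (modeK m)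
  obtain ⟨-, -, hb⟩ := CubicCert.pivots hV (by omega) (by omega) (by omega) (cmodeL_lt6 H1 m)
  exact ⟨⟨hb.1, hb.2.1, hb.2.2.1⟩, hb.2.2.2⟩

/-- the pivot row of mode m … -/
def crho6 (hV : Ψ.valid L = true) (H1 : ∀ m : Fin r, off (modeK m) ≤ m.1 ∧ m.1 < off (modeK m) + crs6 Ψ (modeK m)) (m : Fin r) :
    indexSet 6 3 (6 / 2 * 3 - 6 - 2) :=
  ⟨cRow6 (modeK m) (Ψ.rowP (csig6_1 (modeK m)) (csig6_2 (modeK m)) (csig6_3 (modeK m)) (m.1 - off (modeK m))), cRow6_mem _ _ (cpivot_box6 hV H1 m).1⟩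

/-- … and its pivot column. -/
def cgam6 (hV : Ψ.valid L = true) (H1 : ∀ m : Fin r, off (modeK m) ≤ m.1 ∧ m.1 < off (modeK m) + crs6 Ψ (modeK m)) (m : Fin r) :
    indexSet 6 3 3 :=
  ⟨cCol6 (modeK m) (Ψ.colP (csig6_1 (modeK m)) (csig6_2 (modeK m)) (csig6_3 (modeK m)) (m.1 - off (modeK m))), cCol6_mem _ _ (cpivot_box6 hV H1 m).2⟩

/-- heads, tails and pair sums of ρ(m) … -/
theorem crho6_val (hV : Ψ.valid L = true) (H1 : ∀ m : Fin r, off (modeK m) ≤ m.1 ∧ m.1 < off (modeK m) + crs6 Ψ (modeK m)) (m : Fin r) :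
    (crho6 hV H1 m).1 2 = (Ψ.rowP (csig6_1 (modeK m)) (csig6_2 (modeK m)) (csig6_3 (modeK m)) (m.1 - off (modeK m))).1 ∧
    (crho6 hV H1 m).1 4 = (Ψ.rowP (csig6_1 (modeK m)) (csig6_2 (modeK m)) (csig6_3 (modeK m)) (m.1 - off (modeK m))).2.1 ∧
    (crho6 hV H1 m).1 6 = (Ψ.rowP (csig6_1 (modeK m)) (csig6_2 (modeK m)) (csig6_3 (modeK m)) (m.1 - off (modeK m))).2.2 ∧
    (crho6 hV H1 m).1 0 = 0 ∧
    (crho6 hV H1 m).1 0 + (crho6 hV H1 m).1 1 = csig6_0 (modeK m) ∧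
    (crho6 hV H1 m).1 2 + (crho6 hV H1 m).1 3 = csig6_1 (modeK m) ∧
    (crho6 hV H1 m).1 4 + (crho6 hV H1 m).1 5 = csig6_2 (modeK m) ∧
    (crho6 hV H1 m).1 6 + (crho6 hV H1 m).1 7 = csig6_3 (modeK m) :=
  cRow6_val (modeK m) _ (cpivot_box6 hV H1 m).1

/-- … and of γ(m). -/
theorem cgam6_val (hV : Ψ.valid L = true) (H1 : ∀ m : Fin r, off (modeK m) ≤ m.1 ∧ m.1 < off (modeK m) + crs6 Ψ (modeK m)) (m : Fin r) :
    (cgam6 hV H1 m).1 2 = (Ψ.colP (csig6_1 (modeK m)) (csig6_2 (modeK m)) (csig6_3 (modeK m)) (m.1 - off (modeK m))).1 ∧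
    (cgam6 hV H1 m).1 4 = (Ψ.colP (csig6_1 (modeK m)) (csig6_2 (modeK m)) (csig6_3 (modeK m)) (m.1 - off (modeK m))).2.1 ∧
    (cgam6 hV H1 m).1 6 = (Ψ.colP (csig6_1 (modeK m)) (csig6_2 (modeK m)) (csig6_3 (modeK m)) (m.1 - off (modeK m))).2.2 ∧
    (cgam6 hV H1 m).1 0 = 0 ∧
    csig6_0 (modeK m) + ((cgam6 hV H1 m).1 0 + (cgam6 hV H1 m).1 1) = 1 ∧
    csig6_1 (modeK m) + ((cgam6 hV H1 m).1 2 + (cgam6 hV H1 m).1 3) = 1 ∧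
    csig6_2 (modeK m) + ((cgam6 hV H1 m).1 4 + (cgam6 hV H1 m).1 5) = 1 ∧
    csig6_3 (modeK m) + ((cgam6 hV H1 m).1 6 + (cgam6 hV H1 m).1 7) = 1 :=
  cCol6_val (modeK m) _ (cpivot_box6 hV H1 m).2

/-- U on a pivot row: supported on the modes of the same type, with value ζ⁰ · A_shape[h_{ℓ(m)}, ℓ(m')]. -/
theorem CU6_rho (hV : Ψ.valid L = true) (H1 : ∀ m : Fin r, off (modeK m) ≤ m.1 ∧ m.1 < off (modeK m) + crs6 Ψ (modeK m)) (m m' : Fin r) :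
    CU6 ζ Ψ modeK off (crho6 hV H1 m) m' = if modeK m' = modeK m then
      ζ ^ 0 * Z6.eval ζ (Ψ.A (csig6_1 (modeK m)) (csig6_2 (modeK m)) (csig6_3 (modeK m))
        (Ψ.rowP (csig6_1 (modeK m)) (csig6_2 (modeK m)) (csig6_3 (modeK m)) (m.1 - off (modeK m))).1
        (Ψ.rowP (csig6_1 (modeK m)) (csig6_2 (modeK m)) (csig6_3 (modeK m)) (m.1 - off (modeK m))).2.1
        (Ψ.rowP (csig6_1 (modeK m)) (csig6_2 (modeK m)) (csig6_3 (modeK m)) (m.1 - off (modeK m))).2.2 (m'.1 - off (modeK m))) else 0 := by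
  obtain ⟨ea, eb, ee, z0, p0, p1, p2, p3⟩ := crho6_val hV H1 m
  unfold CU6
  rw [p0, p1, p2, p3, ea, eb, ee, z0]
  by_cases hk : modeK m' = modeK m
  · rw [if_pos hk, hk, if_pos ⟨rfl, rfl, rfl, rfl⟩]
  · rw [if_neg hk, if_neg]
    intro h
    exact hk (csig_inj6 _ _ h.1.symm h.2.1.symm h.2.2.1.symm h.2.2.2.symm)

/-- V on a pivot column: supported on the modes of the same type, with value ζ^{tails} · B_shape[ℓ(m), g_{ℓ(m')}]. -/
theorem CV6_gam (hV : Ψ.valid L = true) (H1 : ∀ m : Fin r, off (modeK m) ≤ m.1 ∧ m.1 < off (modeK m) + crs6 Ψ (modeK m)) (m m' : Fin r) :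
    CV6 ζ Ψ modeK off m (cgam6 hV H1 m') = if modeK m = modeK m' then
      ζ ^ (0 + 1) * Z6.eval ζ (Ψ.B (csig6_1 (modeK m')) (csig6_2 (modeK m')) (csig6_3 (modeK m')) (m.1 - off (modeK m'))
        (Ψ.colP (csig6_1 (modeK m')) (csig6_2 (modeK m')) (csig6_3 (modeK m')) (m'.1 - off (modeK m'))).1
        (Ψ.colP (csig6_1 (modeK m')) (csig6_2 (modeK m')) (csig6_3 (modeK m')) (m'.1 - off (modeK m'))).2.1
        (Ψ.colP (csig6_1 (modeK m')) (csig6_2 (modeK m')) (csig6_3 (modeK m')) (m'.1 - off (modeK m'))).2.2) else 0 := by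
  obtain ⟨ea, eb, ee, z0, p0, p1, p2, p3⟩ := cgam6_val hV H1 m'
  unfold CV6
  by_cases hk : modeK m = modeK m'
  · rw [if_pos hk, hk, p0, p1, p2, p3, ea, eb, ee, z0, if_pos ⟨rfl, rfl, rfl, rfl⟩]
  · rw [if_neg hk, if_neg]
    intro h
    exact hk (csig_inj6 _ _ (by omega) (by omega) (by omega) (by omega))

/-- LOWER BOUND: rank M_δ ≥ r. -/
theorem cle_rank_of_cert6 [CharZero K] (h2 : ζ ^ 2 = ζ - 1) (hV : Ψ.valid L = true)
    (H1 : ∀ m : Fin r, off (modeK m) ≤ m.1 ∧ m.1 < off (modeK m) + crs6 Ψ (modeK m)) (H2 : ∀ k : Fin 4, off k + crs6 Ψ k ≤ r)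
    (H3 : ∀ m : Fin r, ∀ k : Fin 4, off k ≤ m.1 → m.1 < off k + crs6 Ψ k → modeK m = k) :
    r ≤ (ivhsMatrix 6 3 ζ (cplaneList6 L)).rank := by
  classical
  have hz : ζ ≠ 0 := by
    rintro rfl
    norm_num at h2
  set M := ivhsMatrix 6 3 ζ (cplaneList6 L) with hM
  have hS : M.submatrix (crho6 hV H1) (cgam6 hV H1) =
      (CU6 ζ Ψ modeK off).submatrix (crho6 hV H1) id * (CV6 ζ Ψ modeK off).submatrix id (cgam6 hV H1) := by
    rw [hM, ivhsMatrix_cplaneList6_eq_mul ζ L Ψ modeK off h2 hV H1 H2 H3]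
    exact Matrix.submatrix_mul _ _ _ _ _ Function.bijective_id
  -- the left factor of the minor is lower triangular with nonzero diagonal
  have hUt : ((CU6 ζ Ψ modeK off).submatrix (crho6 hV H1) id).BlockTriangular OrderDual.toDual := by
    intro m m' hlt
    have hlt' : m < m' := OrderDual.toDual_lt_toDual.mp hlt
    rw [Matrix.submatrix_apply, id_eq, CU6_rho ζ hV H1]
    by_cases hk : modeK m' = modeK m
    · rw [if_pos hk]
      obtain ⟨l0, l1, l2, l3⟩ := csig_le6 (modeK m)
      obtain ⟨hℓ, hℓ'⟩ := PlaneSum.modeL_lt_of_lt modeK off (crs6 Ψ) H1 hlt' hk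
      rw [CubicCert.A_upper_zero hV (by omega) (by omega) (by omega) (cmodeL_lt6 H1 m) hℓ' hℓ, Z6.zero_def, Z6.eval_zero, mul_zero]
    · rw [if_neg hk]
  have hUd : ∀ m : Fin r, ((CU6 ζ Ψ modeK off).submatrix (crho6 hV H1) id) m m ≠ 0 := by
    intro m
    rw [Matrix.submatrix_apply, id_eq, CU6_rho ζ hV H1, if_pos rfl]
    obtain ⟨l0, l1, l2, l3⟩ := csig_le6 (modeK m)
    exact mul_ne_zero (pow_ne_zero _ hz) (Z6.eval_ne_zero_of_posConst ζ (CubicCert.pivots hV (by omega) (by omega) (by omega) (cmodeL_lt6 H1 m)).1)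
  -- the right factor of the minor is upper triangular with nonzero diagonal
  have hVt : ((CV6 ζ Ψ modeK off).submatrix id (cgam6 hV H1)).BlockTriangular id := by
    intro m m' hlt
    have hlt' : m' < m := hlt
    rw [Matrix.submatrix_apply, id_eq, CV6_gam ζ hV H1]
    by_cases hk : modeK m = modeK m'
    · rw [if_pos hk]
      obtain ⟨l0, l1, l2, l3⟩ := csig_le6 (modeK m')
      obtain ⟨hℓ, hℓ'⟩ := PlaneSum.modeL_lt_of_lt modeK off (crs6 Ψ) H1 hlt' hk
      rw [CubicCert.B_lower_zero hV (by omega) (by omega) (by omega) (cmodeL_lt6 H1 m') hℓ' hℓ, Z6.zero_def, Z6.eval_zero, mul_zero]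
    · rw [if_neg hk]
  have hVd : ∀ m : Fin r, ((CV6 ζ Ψ modeK off).submatrix id (cgam6 hV H1)) m m ≠ 0 := by
    intro m
    rw [Matrix.submatrix_apply, id_eq, CV6_gam ζ hV H1, if_pos rfl]
    obtain ⟨l0, l1, l2, l3⟩ := csig_le6 (modeK m)
    have hBw := Z6.eval_ne_zero_of_posConst ζ (CubicCert.pivots hV (by omega) (by omega) (by omega) (cmodeL_lt6 H1 m)).2.1
    rw [Z6.eval_mul ζ h2] at hBw
    exact mul_ne_zero (pow_ne_zero _ hz) (left_ne_zero_of_mul hBw)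
  have hdet : IsUnit (M.submatrix (crho6 hV H1) (cgam6 hV H1)).det := by
    rw [hS, Matrix.det_mul, Matrix.det_of_lowerTriangular _ hUt, Matrix.det_of_upperTriangular hVt]
    exact isUnit_iff_ne_zero.mpr (mul_ne_zero (Finset.prod_ne_zero_iff.mpr fun m _ => hUd m)
      (Finset.prod_ne_zero_iff.mpr fun m _ => hVd m))
  have hrank : (M.submatrix (crho6 hV H1) (cgam6 hV H1)).rank = r := by
    rw [Matrix.rank_of_isUnit _ ((Matrix.isUnit_iff_isUnit_det _).mpr hdet), Fintype.card_fin]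
  calc r = (M.submatrix (crho6 hV H1) (cgam6 hV H1)).rank := hrank.symm
    _ ≤ M.rank := Matrix.rank_submatrix_le M _ _

/-- MAIN THEOREM (cubic, n = 6): a valid cubic core certificate with a mode enumeration decides the row `IvhsRankEq 6 3 r (cplaneList6 L)`. -/
theorem ivhsRankEq3_of_cert6 (L : List (ℤ × ℕ × ℕ × ℕ)) (Ψ : CubicCert) (hV : Ψ.valid L = true) {r : ℕ} (modeK : Fin r → Fin 4)
    (off : Fin 4 → ℕ) (H1 : ∀ m : Fin r, off (modeK m) ≤ m.1 ∧ m.1 < off (modeK m) + crs6 Ψ (modeK m))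
    (H2 : ∀ k : Fin 4, off k + crs6 Ψ k ≤ r) (H3 : ∀ m : Fin r, ∀ k : Fin 4, off k ≤ m.1 → m.1 < off k + crs6 Ψ k → modeK m = k) :
    IvhsRankEq 6 3 r (cplaneList6 L) := by
  intro K _ _ ζ hζ
  have h2 : ζ ^ 2 = ζ - 1 := (primRoot6_facts ζ hζ).2.2
  exact le_antisymm (crank_le_of_cert6 ζ L Ψ modeK off h2 hV H1 H2 H3) (cle_rank_of_cert6 ζ h2 hV H1 H2 H3)

end cert

end Summit.HodgeConjecture.HodgeConjecture.HodgeLocus.Census.CubicSum
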